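import Mathlib
import Summits.NavierStokesRegularity.NavierStokesRegularity.Theorems.TaoLadderRungTwoFlatTubeBlock
import Summits.NavierStokesRegularity.NavierStokesRegularity.Theorems.TaoLadderRungTwoFlatZoneLevels
import Summits.NavierStokesRegularity.NavierStokesRegularity.Theorems.TaoLadderRungTwoFlatExistTubeGlue
import HarnessLib

/-!
# THE K4 TUBE-TYPE BOUND AT A HOP `n > N₀` WITH ITS ZONE LEVELS PRODUCED (near/behind from the loops of record, window from the
  conditional core-block enclosure)
  (helper for the K_A♭ parent item stmt-NavierStokesRegularity-22987 `FlatGapCertificatesV2`, child 2A, route TaoLadderRungTwoFlat;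
  cell harvest/h2-tao-ladder, p1 g25; referee A-133 «K4 at tube hops OPEN until a producer of `hlev` lands» — this is that producer)

* `tubeB_of_block` — the input `htubeB n` of `tubeExistWith_of_phases` (…ExistTubeFinal): for every pair of caps `(Λ_b ≥ 0, B_z)` a uniform
  `ω`-bound of the kick-ball states of `H(n)` below the caps and of all their short flows, = `apriori_tube_uniform` (…ExistTubeGlue) with
  `hlev` ASSEMBLED from `zoneLevels_of_schedule_slot` (…ZoneLevels: behind `C_z e^{(θ′/2)(−K−k)}`, window bottom `M + A` on `[−K, 1−K]`;
  its core input `ρ₂` along the short flows is read off the block deviation) and `tubeLevels_of_conditionalBlock_ball` (…TubeBlock: window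
  `M^W_k + D_k` on `[2−K, k_H+1]`), given level rows `H_k` dominating both, `ω_k H_k ≤ B_H`, `H_{k_H+1} ≤ V_top`, the strict wake rate
  `θ′ < 5 log(1+ε₀)` (so that a deep shell exists), the weight rows and the cut schedule.

HONEST FRAMING: composition over the cell's typed frame (MODEL lattice); the conditional block row, the reference family `W z` and every
scalar row are BOOKED HYPOTHESES; nothing certified; no item closed; nothing about the Navier–Stokes equations.
-/

noncomputable section

-- the sub-problem namespace repeats the summit name by design (D-0017)
set_option linter.dupNamespace false

namespace Summit.NavierStokesRegularity.NavierStokesRegularity.Theorems.HopTube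

open Set Finset Filter Topology Literature.Analysis.FluidPDE Literature.Analysis.FluidPDE.TaoCascade MirrorPulse RenormFrame QuadPolar
  GappedFrontRobustOn

section K4

variable {ε ε₀ : ℝ}

set_option maxHeartbeats 1600000 in
/-- **THE K4 TUBE-TYPE BOUND AT A HOP `n > N₀` FROM THE BLOCK** (the input `htubeB n` of `tubeExistWith_of_phases`, …ExistTubeFinal): for
every pair of caps `(Λ_b ≥ 0, B_z)`, a uniform `ω`-bound of the kick-ball states of `H(n)` below the caps and of all their short flows —
`apriori_tube_uniform` (…ExistTubeGlue) with its zone levels PRODUCED: behind and window bottom `[−K, 1−K]` by `zoneLevels_of_schedule_slot`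
(…ZoneLevels; its core input `ρ₂` along the short flows read off the block deviation), the window `[2−K, k_H+1]` by
`tubeLevels_of_conditionalBlock_ball`; given level rows `M + A ≤ H_k` (`−K ≤ k ≤ 1−K`), `M^W_k + D_k ≤ H_k` (`2−K ≤ k ≤ k_H+1`),
`ω_k H_k ≤ B_H`, `H_{k_H+1} ≤ V_top`, the strict wake rate `θ′ < 5 log(1+ε₀)` and the weight rows.
[cite: Tao2016AveragedNS, §4 Lemma 4.1 (4.5), (4.8)–(4.10), §5 (statement shape); Teschl2012, Cor. 2.16; cell LADDER §47.5 L2 (K4), §70, referee A-133/A-134] -/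
theorem tubeB_of_block (P : TubeSchedule) {θ' : ℝ} {Wb : ℕ → ℝ} {i₀ : Fin 2}
    {Bcl : ℕ → (Fin 2 → ℤ → ℝ) → Prop} (hBcl : ∀ m z, Bcl m z → behindR54 P θ' Wb m z)
    {X₀ : Fin 2 → ℝ} {w ω : ℤ → ℝ} {r c₀ : ℝ} {ζ : ℕ → Fin 2 → ℤ → ℝ} {ustar : Fin 2 → ℤ → ℝ} {n : ℕ}
    {cW κ₂ : ℝ} {W₀ FW₀ BW₀ : (Fin 2 → ℤ → ℝ) → Fin 2 → ℤ → ℝ} {W FW : (Fin 2 → ℤ → ℝ) → Fin 2 → ℤ → ℝ → ℝ}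
    (hWflow : ∀ z, InTubeWith P Bcl i₀ X₀ w r ζ ustar n z →
      PseudoFlowOnShift shiftSetFlat cW ε₀ (mirrorTable ε ε) 0 κ₂ (W₀ z) (FW₀ z) (BW₀ z) (W z) (FW z)) (hcW : c₀ ≤ cW)
    (hε : 0 ≤ ε) (hε₀ : 0 < ε₀) (hn : P.N₀ < n) (hK : 1 ≤ P.K) (hDK : P.K + 1 ≤ P.D) (hθV : 0 < P.θV)
    (hθ : 0 < θ') (hθ5 : θ' < 5 * Real.log (1 + ε₀)) (hw1 : ∀ k, 1 ≤ w k) (hr0 : 0 ≤ r) (hc₀ : 0 < c₀)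
    (hAstar : 0 < P.Astar) {ωK MuK : ℝ} (hωK : 0 < ωK)
    (hωKle : ∀ i, ωK ≤ MirrorPulse.geomGauge P.g P.b i (-(P.K : ℤ))) (hMuK : ∀ i, |ustar i (-(P.K : ℤ))| ≤ MuK)
    (hWbn : 0 ≤ Wb n)
    -- the Banach weight
    {Ωw Ωb : ℝ} (hω0 : ∀ k, 0 ≤ ω k) (hΩw : 0 ≤ Ωw) (hωw : ∀ k, ω k ≤ Ωw * w k) (hΩb : 0 ≤ Ωb)
    (hωb : ∀ k, k < -(P.K : ℤ) → ω k ≤ Ωb)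
    -- the interface-loop schedule (as in `zoneLevels_of_schedule_slot` / `tubeRows_of_conditionalBlock`)
    {Aeff A A₀ A₁ M M₁ M₂ rI RBAR BBAR RHO2 rs I₁ I₂ PUMP μN μB VbarN VbarB EW V₀N V₀B EN : ℝ}
    (hAeff : 0 < Aeff) (hM0 : 0 ≤ M)
    (hM : ∀ z, InTubeWith P Bcl i₀ X₀ w r ζ ustar n z →
      ∀ s ∈ Icc 0 c₀, ∀ i, ∀ m ∈ Finset.Icc (-(P.D : ℤ)) (1 - (P.K : ℤ)), |W z i m s| ≤ M)
    (hM₁ : ∀ z, InTubeWith P Bcl i₀ X₀ w r ζ ustar n z → ∀ s ∈ Icc 0 c₀, |W z 1 (-(P.K : ℤ)) s| ≤ M₁)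
    (hM₂0 : 0 ≤ M₂)
    (hM₂ : ∀ z, InTubeWith P Bcl i₀ X₀ w r ζ ustar n z → ∀ s ∈ Icc 0 c₀, |W z 0 (2 - (P.K : ℤ)) s| ≤ M₂)
    (hEW : ∀ z, InTubeWith P Bcl i₀ X₀ w r ζ ustar n z →
      coMovingEnergyOn (Finset.Icc (1 - (P.D : ℤ)) (-(P.K : ℤ))) P.θV (-(P.K : ℝ))
        (fun i k _ => anchorScale P i₀ z * ustar i k - W₀ z i k) 0 ≤ EW)
    (hρ0 : 0 ≤ RHO2)
    (hRB0 : 0 < RBAR) (hBB0 : 0 < BBAR) (hRr : RBAR ≤ rI) (hBr : BBAR ≤ rI) (hVN0 : 0 ≤ VbarN)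
    (hI₁0 : 0 ≤ I₁) (hI₂0 : 0 ≤ I₂)
    (hI₁ : 2 * (Real.exp (P.θV / 2) - 1) ≤ I₁ * P.θV) (hI₂ : Real.exp P.θV - 1 ≤ I₂ * P.θV)
    (hPUMPdef : PUMP = 1 * c₀ * ((2 + ε) * M * I₁ * Real.sqrt (2 * VbarN) + 2 * I₂ * VbarN))
    (hlevC : rs + PUMP + 1 * c₀ * ((ε * (M + I₁ * Real.sqrt (2 * VbarN)) + ε * M + ε * BBAR) * RBAR
      + (2 + ε) * M * BBAR + BBAR ^ 2) < RBAR)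
    (hlevV : rs + 1 * c₀ * ((M + M₂ + RBAR + RHO2) * BBAR + (1 + 2 * ε) * M * RBAR + ε * RBAR ^ 2
      + (M + 2 * ε * M₂) * RHO2 + ε * RHO2 ^ 2) < BBAR)
    (hAdef : A = Real.sqrt (2 * VbarB) * Real.exp (θ' / 2) * Real.exp (θ' * ((P.D : ℝ) - P.K) / 2) + M)
    (hA₀def : A₀ = M + rI) (hA₁def : A₁ = M₁ + Real.sqrt (2 * VbarN) * Real.exp (P.θV / 2))
    (hrA : rI ≤ A) (hA₀le : A₀ ≤ Aeff)
    (hV₀Ndef : V₀N = (Real.sqrt (P.v n + (P.δ n / ωK) ^ 2) + Real.sqrt P.D * r + Real.sqrt EW) ^ 2)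
    (hV₀Bdef : V₀B = (Real.sqrt (Wb n + (MuK + P.δ n / ωK) ^ 2) + r / Real.sqrt (1 - Real.exp (-θ'))) ^ 2)
    (hENdef : EN = Real.exp (P.θV * ((1 : ℝ) - P.D + P.K)) * ((1 + ε) * 1 * A ^ 2 * (A + M))
      + 1 * rI * (2 * VbarN + ε * rI * Real.sqrt (2 * VbarN) + (1 + ε) * M * rI))
    (hμN : 0 < μN)
    (hμNle : μN ≤ (1 / c₀) * P.θV - 2 * (1 + ε) * 1 * (A * Real.sinh (P.θV / 2) + M * (3 + Real.exp P.θV)))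
    (hμB : 0 < μB) (hμBle : μB ≤ (1 / c₀) * θ' - 2 * (1 + ε) * Aeff * Real.sinh (θ' / 2))
    (hlevN : V₀N + EN * c₀ < VbarN) (hlevB : V₀B + A₁ * A₀ * (A₁ + ε * A₀) * c₀ < VbarB)
    (hclose : Real.sqrt (2 * VbarB) * Real.exp (θ' / 2) ≤ Aeff)
    (hsec : ∀ z S₀ s S F, InTubeWith P Bcl i₀ X₀ w r ζ ustar n z → (∀ i k, w k * |S₀ i k - z i k| ≤ r) → 0 < s →
      PseudoFlowOnShift shiftSetFlat s ε₀ (mirrorTable ε ε) 0 0 S₀ (fun i k => (1 / 2) * S₀ i k ^ 2) (fun _ _ => 0) S F →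
        ∀ i, |(S - W z) i (1 - (P.K : ℤ)) 0| ≤ rs)
    -- THE CORE BLOCK `[2−K, k_H+1]` (conditional row, profile, reference hulls, first cut)
    {kH : ℤ} (hKH : 2 - (P.K : ℤ) ≤ kH + 1) (hk₁H : (P.k₁ : ℤ) ≤ kH + 2) {Dk G Ω MW Hk : ℤ → ℝ} {Vtop BH BG : ℝ}
    (hGpos : 0 < G (kH + 1)) (hVtop : 0 ≤ Vtop)
    (hblock : ∀ z S₀ s S F, InTubeWith P Bcl i₀ X₀ w r ζ ustar n z → (∀ i k, w k * |S₀ i k - z i k| ≤ r) → 0 < s →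
      PseudoFlowOnShift shiftSetFlat s ε₀ (mirrorTable ε ε) 0 0 S₀ (fun i k => (1 / 2) * S₀ i k ^ 2) (fun _ _ => 0) S F →
        ∀ t ∈ Icc 0 c₀, t ≤ s →
          (∀ s' ∈ Icc 0 t, |(S - W z) 0 (1 - (P.K : ℤ)) s'| ≤ 2 * RBAR ∧ |(S - W z) 1 (1 - (P.K : ℤ)) s'| ≤ 2 * BBAR ∧
              ∀ i : Fin 2, |S i (kH + 1 + 1) s'| ≤ 4 * G (kH + 1)) →
            ∀ s' ∈ Icc 0 t, ∀ (i : Fin 2) (k : ℤ), 2 - (P.K : ℤ) ≤ k → k ≤ kH + 1 → |(S - W z) i k s'| ≤ Dk k)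
    (hρD : Dk (2 - (P.K : ℤ)) ≤ RHO2)
    (hrefV : ∀ z, InTubeWith P Bcl i₀ X₀ w r ζ ustar n z → ∀ s ∈ Icc 0 c₀, |W z 1 (kH + 1) s| + Dk (kH + 1) ≤ Vtop)
    (hMW : ∀ z, InTubeWith P Bcl i₀ X₀ w r ζ ustar n z → ∀ s ∈ Icc 0 c₀, ∀ (i : Fin 2) (k : ℤ), 2 - (P.K : ℤ) ≤ k → k ≤ kH + 1 →
      |W z i k s| ≤ MW k)
    -- LEVEL ROWS: window levels `H_k` on `[−K, k_H+1]`, their `ω`-bound, the hull at `k_H+1`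
    (hHkN : ∀ k : ℤ, -(P.K : ℤ) ≤ k → k ≤ 1 - (P.K : ℤ) → M + A ≤ Hk k)
    (hHkW : ∀ k : ℤ, 2 - (P.K : ℤ) ≤ k → k ≤ kH + 1 → MW k + Dk k ≤ Hk k)
    (hHω : ∀ k : ℤ, -(P.K : ℤ) ≤ k → k ≤ kH + 1 → ω k * Hk k ≤ BH) (hHV : Hk (kH + 1) ≤ Vtop)
    -- the cut schedule beyond `k_H`
    (hG0 : ∀ j, kH < j → 0 ≤ G j)
    (hΩ : ∀ j, kH < j → ∀ N : Finset ℤ, (∀ m ∈ N, j < m) → ∑ m ∈ N, (w m)⁻¹ ^ 2 ≤ Ω j)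
    (hGΩ : ∀ j, kH < j → 2 * (9 / 8 * r) ^ 2 * Ω j ≤ G j ^ 2)
    (hclose0 : 4 / 3 * c₀ * clock ε₀ (kH + 1) * Vtop * (Vtop + 2 * ε * G (kH + 1)) < G (kH + 1))
    (hcloseG : ∀ j, kH + 1 ≤ j →
      4 / 3 * c₀ * clock ε₀ (j + 1) * (2 * G j) * (2 * G j + 2 * ε * G (j + 1)) < G (j + 1))
    (hGω : ∀ k : ℤ, kH + 1 < k → ω k * (2 * G (k - 1)) ≤ BG) :
    ∀ Λb Bz : ℝ, 0 ≤ Λb → ∃ B : ℝ, ∀ z S₀ : Fin 2 → ℤ → ℝ, InTubeWith P Bcl i₀ X₀ w r ζ ustar n z →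
      (∀ (i : Fin 2) (k : ℤ), k < -(P.K : ℤ) → |z i k| ≤ Λb) → (∀ i k, ω k * |z i k| ≤ Bz) → (∀ i k, w k * |S₀ i k - z i k| ≤ r) →
        (∀ (i : Fin 2) (k : ℤ), ω k * |S₀ i k| ≤ B) ∧
          ∀ s : ℝ, 0 < s → s ≤ c₀ → ∀ S F : Fin 2 → ℤ → ℝ → ℝ,
            PseudoFlowOnShift shiftSetFlat s ε₀ (mirrorTable ε ε) 0 0 S₀ (fun i k => (1 / 2) * S₀ i k ^ 2) (fun _ _ => 0) S F →
              ∀ t ∈ Icc 0 s, ∀ (i : Fin 2) (k : ℤ), ω k * |S i k t| ≤ B := by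
  intro Λb Bz hΛb
  -- the block data along the short flows
  have hball := tubeLevels_of_conditionalBlock_ball P hBcl hWflow hcW hε hε₀ hn hK hDK hθV hθ hθ5.le hw1 hr0 hc₀ hAstar hωK hωKle
    hMuK hWbn hAeff hM0 hM hM₁ hM₂0 hM₂ hEW hρ0 hRB0 hBB0 hRr hBr hVN0 hI₁0 hI₂0 hI₁ hI₂ hPUMPdef hlevC hlevV hAdef hA₀def hA₁def hrA
    hA₀le hV₀Ndef hV₀Bdef hENdef hμN hμNle hμB hμBle hlevN hlevB hclose hsec hKH hk₁H hGpos hVtop hblock hρD hrefV hMW hΩ hGΩ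
    hclose0
  -- the near/behind zone levels from the loops of record, the core input read off the block
  have hzone := zoneLevels_of_schedule_slot P hBcl hWflow hcW hε hε₀ hn hK hDK hθV hθ hθ5.le hw1 hr0 hAstar hωK hωKle hMuK hWbn
    hc₀ hAeff hM0 hM hM₁ hM₂0 hM₂ hEW (fun z S₀ s S F hz hkick hs _ hS => hsec z S₀ s S F hz hkick hs hS) hρ0
    (fun z S₀ s S F hz hkick hs hsc hS s' hs' => ((hball z S₀ s S F hz hkick hs hsc hS s' hs').1 0 (2 - (P.K : ℤ)) le_rfl hKH).trans
      hρD)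
    hRB0.le hBB0.le hRr hBr hVN0 hI₁0 hI₂0 hI₁ hI₂ hPUMPdef hlevC hlevV hAdef hA₀def hA₁def hrA hA₀le hV₀Ndef hV₀Bdef hENdef hμN
    hμNle hμB hμBle hlevN hlevB hclose
  -- the behind decay constant and rate
  set Cz : ℝ := Real.sqrt (2 * (V₀B + A₁ * A₀ * (A₁ + ε * A₀) * c₀)) * Real.exp (θ' / 2) with hCz
  have hCz0 : 0 ≤ Cz := by positivity
  have hθb0 : 0 ≤ θ' / 2 := by linarith
  have hθb : θ' / 2 < 5 / 2 * Real.log (1 + ε₀) := by linarith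
  have hKH' : -(P.K : ℤ) ≤ kH + 1 := by omega
  refine apriori_tube_uniform P hε hε₀ hc₀ hn hr0 hw1 hω0 hΩw hωw hΩb hωb hΛb (Hb := fun k => Cz * Real.exp (θ' / 2 * (-(P.K : ℝ) - k)))
    (Hk := Hk) (Cb := Cz) (θb' := θ' / 2) hKH' ?_ hCz0 hθb0 hθb (fun k _ => le_rfl) hHω hk₁H hVtop hHV hG0 hΩ hGΩ hclose0 hcloseG hGω
  -- the levels along every short flow
  intro z S₀ s S F hz hkick hs hsc hS t ht i k
  have hzl := hzone z S₀ s S F hz hkick hs hsc hS t ht i k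
  have hbl := hball z S₀ s S F hz hkick hs hsc hS t ht
  refine ⟨fun hk => ?_, fun hk1 hk2 => ?_⟩
  · have h := hzl.1 hk
    simp only [hCz]
    calc |S i k t| ≤ Real.sqrt (2 * (V₀B + A₁ * A₀ * (A₁ + ε * A₀) * c₀)) * Real.exp (θ' / 2)
          * Real.exp (θ' / 2 * (-(P.K : ℝ) - k)) := h
      _ = _ := by ring
  · rcases le_or_gt k (1 - (P.K : ℤ)) with hkN | hkW
    · exact (hzl.2 hk1 hkN).trans (hHkN k hk1 hkN)
    · exact (hbl.2.1 i k (by omega) hk2).trans (hHkW k (by omega) hk2)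

end K4

end Summit.NavierStokesRegularity.NavierStokesRegularity.Theorems.HopTube

end
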